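import Summits.AtomisticToContinuum.Crystallization.Theses.ReggeStarCoercivity
import Summits.AtomisticToContinuum.Crystallization.Theses.PalmUnimodularRigidity
import Summits.AtomisticToContinuum.Crystallization.Theorems.DefectFreeCrystallizes.Negative.PredicateAPI
import Summits.AtomisticToContinuum.Crystallization.Theorems.ReggeStarCoercivityDefectFreeCrystallizesPalmDefs
import Summits.AtomisticToContinuum.Crystallization.Theorems.ReggeStarCoercivityDefectFreeCrystallizesGoodLaw
import Summits.AtomisticToContinuum.Crystallization.Theorems.ReggeStarCoercivityDefectFreeCrystallizesFunnelChart
import Summits.AtomisticToContinuum.Crystallization.Theorems.ReggeStarCoercivityDefectFreeCrystallizesChargeFromFunnelLaw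
import Summits.AtomisticToContinuum.Crystallization.Theorems.ReggeStarCoercivityDefectFreeCrystallizesRouteBetaFloor
import Summits.AtomisticToContinuum.Crystallization.Theorems.ReggeStarCoercivityDefectFreeCrystallizesDefectVersion
import Summits.AtomisticToContinuum.Crystallization.Theorems.ReggeStarCoercivityDefectFreeCrystallizesAnnulusCount
import Summits.AtomisticToContinuum.Crystallization.Theorems.PalmUnimodularRigidityChargedPatternCrystallizes
import Summits.AtomisticToContinuum.Crystallization.Theorems.PalmUnimodularRigidityLayeredLawsSelectHcpDefs
import Summits.AtomisticToContinuum.Crystallization.Theorems.PalmUnimodularRigidityLayeredLawsSelectHcpRelaxedReference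
import Summits.AtomisticToContinuum.Crystallization.Theorems.PalmUnimodularRigidityCruxesToPalmRigidity
import Summits.AtomisticToContinuum.Crystallization.Theorems.ExcessDecayLiouvilleCoarseGrainsHcpEnergySeries
import Literature.Probability.Process.PointStationaryLaw
import Literature.MathematicalPhysics.StatisticalMechanics.BarlowStacking
import Literature.MathematicalPhysics.StatisticalMechanics.LennardJonesClusters
import Literature.Geometry.DiscreteGeometry.KissingPatterns
import Summits.AtomisticToContinuum.Crystallization.Theorems.ReggeStarCoercivityDefectFreeCrystallizesExactFrameH
import Summits.AtomisticToContinuum.Crystallization.Theorems.ReggeStarCoercivityDefectFreeCrystallizesExactFrameC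
import Summits.AtomisticToContinuum.Crystallization.Theorems.ReggeStarCoercivityDefectFreeCrystallizesFramePropagation
import Summits.AtomisticToContinuum.Crystallization.Theorems.ReggeStarCoercivityDefectFreeCrystallizesExactSelectionLawB
import Summits.AtomisticToContinuum.Crystallization.Theorems.MinMeanCycleStackingLockBarlowEnergyIdentification
import Summits.AtomisticToContinuum.Crystallization.Theorems.ReggeStarCoercivityDefectFreeCrystallizesExactStarShortcutRigidity

/-!
# The exact-star shortcut, II: crux `ReggeStarCoercivity.DefectFreeCrystallizes` CLOSED MODULO ITS CORE ALONE
(line `palm-good-law`, lead c9; strategist gen 2 `Lines/exact_star_shortcut.lean`; item stmt-AtomisticToContinuum-13603)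

The law-level CORE of the line (`stub_funnelDefectFloor`, robust funnel floor, the hypothesis `hCORE` below — verbatim the
registered stub) is written with EXACT reference stars, so on the crux's good limit law (`E_P[h] ≤ e* ≤ hcpE a₀ h₀`) it yields
`E_P[Dm] = 0`: almost surely EVERY star is exact (`ae_exactRoot_of_core` + Aldous–Lyons).  The remaining geometry and selection are
LANDED: X2a `ExactFrameH.stub_exactFrameH` (p156194), X2b `ExactFrameC.stub_exactFrameC` (p158272), X2c
`FramePropagation.stub_framePropagation` (p159157) — assembled here into X2 `stub_exactStarRigidity` (exact stars everywhere on a charted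
set ⇒ an exact rotated Barlow stacking; glue = re-rooting the chart by a WORD SHIFT, `barlowPos_add_shift`) — and X3
`ExactSelectionLawB.stub_exactSelectionLawB` (p161691; selection at exact geometry over the landed LJ column).  Hence
`defectFreeCrystallizes_of_core : CORE → DefectFreeCrystallizes` WITHOUT crux 9226 (compare
`RouteBetaDefectFloor.defectFreeCrystallizes_of_funnelDefectFloor : CORE → LayeredLawsSelectHcp → DefectFreeCrystallizes`, p150082). -/

noncomputable section

open scoped BigOperators ENNReal
open Filter Topology MeasureTheory

namespace Summit.AtomisticToContinuum.Crystallization.Theorems.PalmGoodLaw.ExactStarShortcut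

open Summit.AtomisticToContinuum.Crystallization.Theses
open Summit.AtomisticToContinuum.Crystallization.Theses.ReggeStarCoercivity
open Summit.AtomisticToContinuum.Crystallization.Theorems.DefectFreeCrystallizes.Negative.PredicateAPI
open Literature.MathematicalPhysics.StatisticalMechanics Literature.Geometry.DiscreteGeometry
open Literature.Probability.Process
open Summit.AtomisticToContinuum.Crystallization.Theorems.PalmGoodLaw (SetGood)



section ExactStarGlue

open Summit.AtomisticToContinuum.Crystallization.Theorems.PalmUnimodularRigidity.LayeredLawsSelectHcp
  (hcpE hcpQ hcpSite hcpStarIdx rootStar starDefect starDefect_nonneg stub_relaxedReference)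
open Summit.AtomisticToContinuum.Crystallization.Theorems.PalmUnimodularRigidity
  (ae_forall_map_sub_of_ae count_restrict_floorNorm_preimage_lt_top)

/-! ## Glue 1 (no sorry): the CORE forces a.s. EXACT root stars on a law at the level `hcpE a₀ h₀` (V ×2 + A as in lead c8's v27 glue, then `lintegral_eq_zero_iff'`) -/

/-- **CORE ⇒ a.s. exact root star** (and the level is attained: `hcpE a₀ h₀ ≤ E_P[h]`). [folklore] -/
theorem ae_exactRoot_of_core
    (hCORE : ∀ a₀ h₀ : ℝ, 189 / 200 ≤ a₀ → a₀ ≤ 199 / 200 → 77 / 100 ≤ h₀ → h₀ ≤ 163 / 200 →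
      (∀ a h : ℝ, 0 < a → 0 < h → hcpE a₀ h₀ ≤ hcpE a h) →
      ∀ δ : ℝ, 0 < δ → ∃ κ : ℝ, 0 < κ ∧
        ∀ Dm : Measure (EuclideanSpace ℝ (Fin 3)) → ℝ≥0∞, Measurable Dm →
          (∀ μ : Measure (EuclideanSpace ℝ (Fin 3)), IsRootedHardCore δ μ →
            Dm μ = ENNReal.ofReal
              (min (starDefect a₀ h₀ μ)
                  (⨅ A : EuclideanSpace ℝ (Fin 3) ≃ₗᵢ[ℝ] EuclideanSpace ℝ (Fin 3),
                    ∑ p ∈ fccKissingPattern, Metric.infDist (A (a₀ • p)) (rootStar μ) ^ 2) +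
                (μ {y : EuclideanSpace ℝ (Fin 3) | 11 / 10 < ‖y‖ ∧ ‖y‖ ≤ 5 / 4}).toReal)) →
          ∀ P : Measure (Measure (EuclideanSpace ℝ (Fin 3))), IsProbabilityMeasure P →
            (∀ᵐ μ ∂P, IsRootedHardCore δ μ) → IsPointStationaryLaw P →
            (∀ᵐ μ ∂P, ∃ S : Set (EuclideanSpace ℝ (Fin 3)),
              μ = (Measure.count : Measure (EuclideanSpace ℝ (Fin 3))).restrict S ∧
              (∀ y ∈ S, SetGood S y) ∧
              ∃ s : ℤ → ℤ, IsHaggSeq s ∧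
                ∃ Φ : EuclideanSpace ℝ (Fin 3) → EuclideanSpace ℝ (Fin 3),
                  Set.BijOn Φ (barlowStacking 1 (Real.sqrt (2 / 3)) s) S ∧
                  ∀ p ∈ barlowStacking 1 (Real.sqrt (2 / 3)) s, ∀ q ∈ barlowStacking 1 (Real.sqrt (2 / 3)) s,
                    (dist p q = 1 ↔ (0 < dist (Φ p) (Φ q) ∧ dist (Φ p) (Φ q) < 6 / 5))) →
            (∀ᵐ μ ∂P, ∃ S : Set (EuclideanSpace ℝ (Fin 3)),
              μ = (Measure.count : Measure (EuclideanSpace ℝ (Fin 3))).restrict S ∧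
              ∀ p ∈ S, HasSum (fun q : {q : EuclideanSpace ℝ (Fin 3) // q ∈ S ∧ q ≠ p} =>
                (deriv lennardJones (dist p q.1) / dist p q.1) • (p - q.1)) 0) →
            (∀ M : EuclideanSpace ℝ (Fin 3) →L[ℝ] EuclideanSpace ℝ (Fin 3),
              ∫ μ, (∫ y, deriv lennardJones ‖y‖ / ‖y‖ * inner ℝ y (M y) ∂μ) ∂P = 0) →
            hcpE a₀ h₀ + κ * (∫⁻ μ, Dm μ ∂P).toReal ≤ ∫ μ, (∫ y, lennardJones ‖y‖ ∂μ) / 2 ∂P)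
    {a₀ h₀ : ℝ} (ha₁ : 189 / 200 ≤ a₀) (ha₂ : a₀ ≤ 199 / 200) (hh₁ : 77 / 100 ≤ h₀) (hh₂ : h₀ ≤ 163 / 200)
    (hmin : ∀ a h : ℝ, 0 < a → 0 < h → hcpE a₀ h₀ ≤ hcpE a h)
    {δ : ℝ} (hδ : 0 < δ) {P : Measure (Measure (EuclideanSpace ℝ (Fin 3)))} [hP : IsProbabilityMeasure P]
    (hhc : ∀ᵐ μ ∂P, IsRootedHardCore δ μ) (hstat : IsPointStationaryLaw P)
    (hchart : ∀ᵐ μ ∂P, ∃ S : Set (EuclideanSpace ℝ (Fin 3)),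
      μ = (Measure.count : Measure (EuclideanSpace ℝ (Fin 3))).restrict S ∧
      (∀ y ∈ S, SetGood S y) ∧
      ∃ s : ℤ → ℤ, IsHaggSeq s ∧
        ∃ Φ : EuclideanSpace ℝ (Fin 3) → EuclideanSpace ℝ (Fin 3),
          Set.BijOn Φ (barlowStacking 1 (Real.sqrt (2 / 3)) s) S ∧
          ∀ p ∈ barlowStacking 1 (Real.sqrt (2 / 3)) s, ∀ q ∈ barlowStacking 1 (Real.sqrt (2 / 3)) s,
            (dist p q = 1 ↔ (0 < dist (Φ p) (Φ q) ∧ dist (Φ p) (Φ q) < 6 / 5)))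
    (hFB : ∀ᵐ μ ∂P, ∃ S : Set (EuclideanSpace ℝ (Fin 3)),
      μ = (Measure.count : Measure (EuclideanSpace ℝ (Fin 3))).restrict S ∧
      ∀ p ∈ S, HasSum (fun q : {q : EuclideanSpace ℝ (Fin 3) // q ∈ S ∧ q ≠ p} =>
        (deriv lennardJones (dist p q.1) / dist p q.1) • (p - q.1)) 0)
    (hZS : ∀ M : EuclideanSpace ℝ (Fin 3) →L[ℝ] EuclideanSpace ℝ (Fin 3),
      ∫ μ, (∫ y, deriv lennardJones ‖y‖ / ‖y‖ * inner ℝ y (M y) ∂μ) ∂P = 0)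
    (hlevel : (∫ μ, (∫ y, lennardJones ‖y‖ ∂μ) / 2 ∂P) ≤ hcpE a₀ h₀) :
    hcpE a₀ h₀ ≤ (∫ μ, (∫ y, lennardJones ‖y‖ ∂μ) / 2 ∂P) ∧
    ∀ᵐ μ ∂P,
      (starDefect a₀ h₀ μ = 0 ∨
        (⨅ A : EuclideanSpace ℝ (Fin 3) ≃ₗᵢ[ℝ] EuclideanSpace ℝ (Fin 3),
          ∑ p ∈ fccKissingPattern, Metric.infDist (A (a₀ • p)) (rootStar μ) ^ 2) = 0) ∧
      μ {y : EuclideanSpace ℝ (Fin 3) | 11 / 10 < ‖y‖ ∧ ‖y‖ ≤ 5 / 4} = 0 := by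
  classical
  obtain ⟨κ, hκ, hcore⟩ := hCORE a₀ h₀ ha₁ ha₂ hh₁ hh₂ hmin δ hδ
  -- measurable versions of the two star defects (V, instantiated twice) and the annulus packing bound (A)
  set eH := (hcpStarIdx).equivFin with heH
  obtain ⟨Dh, hDh_m, hDh_le, hDh_eq⟩ :=
    Summit.AtomisticToContinuum.Crystallization.Theorems.PalmGoodLaw.DefectVersion.stub_defectVersion _
      (fun i => hcpSite a₀ h₀ ((eH.symm i : hcpStarIdx) : ℤ × ℤ × ℤ)) δ hδ
  set eF := (fccKissingPattern).equivFin with heF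
  obtain ⟨Df, hDf_m, hDf_le, hDf_eq⟩ :=
    Summit.AtomisticToContinuum.Crystallization.Theorems.PalmGoodLaw.DefectVersion.stub_defectVersion _
      (fun i => a₀ • ((eF.symm i : fccKissingPattern) : (EuclideanSpace ℝ (Fin 3)))) δ hδ
  obtain ⟨N, hN⟩ :=
    Summit.AtomisticToContinuum.Crystallization.Theorems.PalmGoodLaw.AnnulusCount.stub_annulusCount δ hδ
  -- the annulus event and the measurable version `Dm` of the defect functional
  set ann : Set (EuclideanSpace ℝ (Fin 3)) := {y : (EuclideanSpace ℝ (Fin 3)) | 11 / 10 < ‖y‖ ∧ ‖y‖ ≤ 5 / 4} with hann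
  have hann_m : MeasurableSet ann :=
    (measurableSet_lt measurable_const measurable_norm).inter (measurableSet_le measurable_norm measurable_const)
  set Dm : Measure (EuclideanSpace ℝ (Fin 3)) → ℝ≥0∞ := fun μ => min (Dh μ) (Df μ) + μ ann with hDm
  have hDm_m : Measurable Dm := (hDh_m.min hDf_m).add (Measure.measurable_coe hann_m)
  -- read-backs of the two instantiated sums
  have hsumH : ∀ (A : (EuclideanSpace ℝ (Fin 3)) ≃ₗᵢ[ℝ] (EuclideanSpace ℝ (Fin 3))) (μ : Measure (EuclideanSpace ℝ (Fin 3))),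
      (∑ i, Metric.infDist (A (hcpSite a₀ h₀ ((eH.symm i : hcpStarIdx) : ℤ × ℤ × ℤ))) (rootStar μ) ^ 2) =
        ∑ v ∈ hcpStarIdx, Metric.infDist (A (hcpSite a₀ h₀ v)) (rootStar μ) ^ 2 := by
    intro A μ
    rw [← Finset.sum_coe_sort hcpStarIdx
      (fun v : ℤ × ℤ × ℤ => Metric.infDist (A (hcpSite a₀ h₀ v)) (rootStar μ) ^ 2)]
    exact Fintype.sum_equiv eH.symm _ _ (fun i => rfl)
  have hsumF : ∀ (A : (EuclideanSpace ℝ (Fin 3)) ≃ₗᵢ[ℝ] (EuclideanSpace ℝ (Fin 3))) (μ : Measure (EuclideanSpace ℝ (Fin 3))),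
      (∑ i, Metric.infDist (A (a₀ • ((eF.symm i : fccKissingPattern) : (EuclideanSpace ℝ (Fin 3))))) (rootStar μ) ^ 2) =
        ∑ p ∈ fccKissingPattern, Metric.infDist (A (a₀ • p)) (rootStar μ) ^ 2 := by
    intro A μ
    rw [← Finset.sum_coe_sort fccKissingPattern
      (fun p : (EuclideanSpace ℝ (Fin 3)) => Metric.infDist (A (a₀ • p)) (rootStar μ) ^ 2)]
    exact Fintype.sum_equiv eF.symm _ _ (fun i => rfl)
  have hstar : ∀ μ : Measure (EuclideanSpace ℝ (Fin 3)), IsRootedHardCore δ μ →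
      Dh μ = ENNReal.ofReal (starDefect a₀ h₀ μ) := by
    intro μ hμ
    rw [hDh_eq μ hμ]
    simp_rw [hsumH]
    rfl
  have hfcc : ∀ μ : Measure (EuclideanSpace ℝ (Fin 3)), IsRootedHardCore δ μ →
      Df μ = ENNReal.ofReal (⨅ A : (EuclideanSpace ℝ (Fin 3)) ≃ₗᵢ[ℝ] (EuclideanSpace ℝ (Fin 3)),
        ∑ p ∈ fccKissingPattern, Metric.infDist (A (a₀ • p)) (rootStar μ) ^ 2) := by
    intro μ hμ
    rw [hDf_eq μ hμ]
    simp_rw [hsumF]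
  have hann_fin : ∀ μ : Measure (EuclideanSpace ℝ (Fin 3)), IsRootedHardCore δ μ → μ ann ≠ ⊤ := fun μ hμ =>
    ne_top_of_le_ne_top (ENNReal.natCast_ne_top N) (hN μ hμ)
  have hfcc_nonneg : ∀ μ : Measure (EuclideanSpace ℝ (Fin 3)), 0 ≤ ⨅ A : (EuclideanSpace ℝ (Fin 3)) ≃ₗᵢ[ℝ] (EuclideanSpace ℝ (Fin 3)),
      ∑ p ∈ fccKissingPattern, Metric.infDist (A (a₀ • p)) (rootStar μ) ^ 2 :=
    fun μ => Real.iInf_nonneg fun _ => Finset.sum_nonneg fun _ _ => sq_nonneg _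
  have hagree : ∀ μ : Measure (EuclideanSpace ℝ (Fin 3)), IsRootedHardCore δ μ →
      Dm μ = ENNReal.ofReal
        (min (starDefect a₀ h₀ μ)
            (⨅ A : (EuclideanSpace ℝ (Fin 3)) ≃ₗᵢ[ℝ] (EuclideanSpace ℝ (Fin 3)),
              ∑ p ∈ fccKissingPattern, Metric.infDist (A (a₀ • p)) (rootStar μ) ^ 2) +
          (μ {y : (EuclideanSpace ℝ (Fin 3)) | 11 / 10 < ‖y‖ ∧ ‖y‖ ≤ 5 / 4}).toReal) := by
    intro μ hμ
    have hmono : Monotone ENNReal.ofReal := fun _ _ h => ENNReal.ofReal_le_ofReal h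
    rw [ENNReal.ofReal_add (le_min (starDefect_nonneg a₀ h₀ μ) (hfcc_nonneg μ)) ENNReal.toReal_nonneg,
      hmono.map_min, ENNReal.ofReal_toReal (hann_fin μ hμ), hDm]
    simp only
    rw [hstar μ hμ, hfcc μ hμ]
  -- the floor on `P`
  have hfloor := hcore Dm hDm_m hagree P hP hhc hstat hchart hFB hZS
  -- finiteness of `E_P[Dm]`
  have hbound : ∀ᵐ μ ∂P, Dm μ ≤
      ENNReal.ofReal (∑ i, (‖hcpSite a₀ h₀ ((eH.symm i : hcpStarIdx) : ℤ × ℤ × ℤ)‖ + 11 / 10) ^ 2) + N := by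
    filter_upwards [hhc] with μ hμ
    exact add_le_add ((min_le_left _ _).trans (hDh_le μ)) (hN μ hμ)
  have hfin : ∫⁻ μ, Dm μ ∂P ≠ ⊤ := by
    refine ne_top_of_le_ne_top ?_ (lintegral_mono_ae hbound)
    rw [lintegral_const, measure_univ, mul_one]
    exact ENNReal.add_ne_top.2 ⟨ENNReal.ofReal_ne_top, ENNReal.natCast_ne_top N⟩
  -- the level is attained and `E_P[Dm] = 0`
  have hnonneg : 0 ≤ κ * (∫⁻ μ, Dm μ ∂P).toReal := mul_nonneg hκ.le ENNReal.toReal_nonneg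
  refine ⟨by linarith, ?_⟩
  have htr0 : (∫⁻ μ, Dm μ ∂P).toReal = 0 := by
    have h1 : κ * (∫⁻ μ, Dm μ ∂P).toReal ≤ κ * 0 := by rw [mul_zero]; linarith
    exact le_antisymm (le_of_mul_le_mul_left h1 hκ) ENNReal.toReal_nonneg
  have hl0 : ∫⁻ μ, Dm μ ∂P = 0 := by
    rcases (ENNReal.toReal_eq_zero_iff _).1 htr0 with h | h
    · exact h
    · exact absurd h hfin
  have hae0 : ∀ᵐ μ ∂P, Dm μ = 0 := (lintegral_eq_zero_iff' hDm_m.aemeasurable).1 hl0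
  filter_upwards [hae0, hhc] with μ h0 hμ
  have hD := hagree μ hμ
  rw [h0] at hD
  have hle := ENNReal.ofReal_eq_zero.1 hD.symm
  have hmin0 : 0 ≤ min (starDefect a₀ h₀ μ)
      (⨅ A : (EuclideanSpace ℝ (Fin 3)) ≃ₗᵢ[ℝ] (EuclideanSpace ℝ (Fin 3)), ∑ p ∈ fccKissingPattern, Metric.infDist (A (a₀ • p)) (rootStar μ) ^ 2) :=
    le_min (starDefect_nonneg a₀ h₀ μ) (hfcc_nonneg μ)
  have htR : 0 ≤ (μ {y : (EuclideanSpace ℝ (Fin 3)) | 11 / 10 < ‖y‖ ∧ ‖y‖ ≤ 5 / 4}).toReal := ENNReal.toReal_nonneg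
  have hm : min (starDefect a₀ h₀ μ)
      (⨅ A : (EuclideanSpace ℝ (Fin 3)) ≃ₗᵢ[ℝ] (EuclideanSpace ℝ (Fin 3)), ∑ p ∈ fccKissingPattern, Metric.infDist (A (a₀ • p)) (rootStar μ) ^ 2) = 0 := by
    linarith
  have ht : (μ {y : (EuclideanSpace ℝ (Fin 3)) | 11 / 10 < ‖y‖ ∧ ‖y‖ ≤ 5 / 4}).toReal = 0 := by linarith
  refine ⟨?_, ?_⟩
  · rcases min_eq_iff.1 hm with h | h
    · exact Or.inl h.1
    · exact Or.inr h.1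
  · rcases (ENNReal.toReal_eq_zero_iff _).1 ht with h | h
    · exact h
    · exact absurd h (hann_fin μ hμ)

/-! ## Glue 2 (no sorry): funnel law rigidity (the hypothesis of the landed R3 `ChargeFromFunnelLaw.stub_chargeFromFunnelLaw`) from the CORE + landed X2/X3 -/

/-- **CORE ⇒ funnel law rigidity** (the hypothesis of the landed R3 `ChargeFromFunnelLaw.stub_chargeFromFunnelLaw`), through the LANDED X2 `ExactStarShortcutRigidity.stub_exactStarRigidity` and X3 `ExactSelectionLawB.stub_exactSelectionLawB`. [folklore] -/
theorem funnelLawRigidity_of_core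
    (hCORE : ∀ a₀ h₀ : ℝ, 189 / 200 ≤ a₀ → a₀ ≤ 199 / 200 → 77 / 100 ≤ h₀ → h₀ ≤ 163 / 200 →
      (∀ a h : ℝ, 0 < a → 0 < h → hcpE a₀ h₀ ≤ hcpE a h) →
      ∀ δ : ℝ, 0 < δ → ∃ κ : ℝ, 0 < κ ∧
        ∀ Dm : Measure (EuclideanSpace ℝ (Fin 3)) → ℝ≥0∞, Measurable Dm →
          (∀ μ : Measure (EuclideanSpace ℝ (Fin 3)), IsRootedHardCore δ μ →
            Dm μ = ENNReal.ofReal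
              (min (starDefect a₀ h₀ μ)
                  (⨅ A : EuclideanSpace ℝ (Fin 3) ≃ₗᵢ[ℝ] EuclideanSpace ℝ (Fin 3),
                    ∑ p ∈ fccKissingPattern, Metric.infDist (A (a₀ • p)) (rootStar μ) ^ 2) +
                (μ {y : EuclideanSpace ℝ (Fin 3) | 11 / 10 < ‖y‖ ∧ ‖y‖ ≤ 5 / 4}).toReal)) →
          ∀ P : Measure (Measure (EuclideanSpace ℝ (Fin 3))), IsProbabilityMeasure P →
            (∀ᵐ μ ∂P, IsRootedHardCore δ μ) → IsPointStationaryLaw P →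
            (∀ᵐ μ ∂P, ∃ S : Set (EuclideanSpace ℝ (Fin 3)),
              μ = (Measure.count : Measure (EuclideanSpace ℝ (Fin 3))).restrict S ∧
              (∀ y ∈ S, SetGood S y) ∧
              ∃ s : ℤ → ℤ, IsHaggSeq s ∧
                ∃ Φ : EuclideanSpace ℝ (Fin 3) → EuclideanSpace ℝ (Fin 3),
                  Set.BijOn Φ (barlowStacking 1 (Real.sqrt (2 / 3)) s) S ∧
                  ∀ p ∈ barlowStacking 1 (Real.sqrt (2 / 3)) s, ∀ q ∈ barlowStacking 1 (Real.sqrt (2 / 3)) s,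
                    (dist p q = 1 ↔ (0 < dist (Φ p) (Φ q) ∧ dist (Φ p) (Φ q) < 6 / 5))) →
            (∀ᵐ μ ∂P, ∃ S : Set (EuclideanSpace ℝ (Fin 3)),
              μ = (Measure.count : Measure (EuclideanSpace ℝ (Fin 3))).restrict S ∧
              ∀ p ∈ S, HasSum (fun q : {q : EuclideanSpace ℝ (Fin 3) // q ∈ S ∧ q ≠ p} =>
                (deriv lennardJones (dist p q.1) / dist p q.1) • (p - q.1)) 0) →
            (∀ M : EuclideanSpace ℝ (Fin 3) →L[ℝ] EuclideanSpace ℝ (Fin 3),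
              ∫ μ, (∫ y, deriv lennardJones ‖y‖ / ‖y‖ * inner ℝ y (M y) ∂μ) ∂P = 0) →
            hcpE a₀ h₀ + κ * (∫⁻ μ, Dm μ ∂P).toReal ≤ ∫ μ, (∫ y, lennardJones ‖y‖ ∂μ) / 2 ∂P) :
    ∀ δ : ℝ, 0 < δ → ∀ P : Measure (Measure (EuclideanSpace ℝ (Fin 3))), IsProbabilityMeasure P →
      (∀ᵐ μ ∂P, IsRootedHardCore δ μ) → IsPointStationaryLaw P →
      (∫ μ, (∫ y, lennardJones ‖y‖ ∂μ) / 2 ∂P) ≤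
        (⨅ Q : PeriodicConfiguration 3, Q.energyPerParticle lennardJones) →
      (∀ᵐ μ ∂P, ∃ S : Set (EuclideanSpace ℝ (Fin 3)),
        μ = (Measure.count : Measure (EuclideanSpace ℝ (Fin 3))).restrict S ∧ ∀ y ∈ S, SetGood S y) →
      ∀ᵐ μ ∂P, ∃ a h : ℝ, ∃ ha : a ≠ 0, ∃ hh : h ≠ 0, 1 / 2 ≤ a ∧ a ≤ 2 ∧ 1 / 2 ≤ h ∧ h ≤ 2 ∧
        ∃ A : EuclideanSpace ℝ (Fin 3) ≃ₗᵢ[ℝ] EuclideanSpace ℝ (Fin 3),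
          (hcpPeriodicConfiguration ha hh).energyPerParticle lennardJones =
            (⨅ Q : PeriodicConfiguration 3, Q.energyPerParticle lennardJones) ∧
          μ = (Measure.count : Measure (EuclideanSpace ℝ (Fin 3))).restrict (A '' hcpStacking a h) := by
  intro δ hδ P hP hcore hstat hE hgood
  -- R1 (landed): chart the funnel
  have hchart : ∀ᵐ μ ∂P, ∃ S : Set (EuclideanSpace ℝ (Fin 3)),
      μ = (Measure.count : Measure (EuclideanSpace ℝ (Fin 3))).restrict S ∧
      (∀ y ∈ S, SetGood S y) ∧
      ∃ s : ℤ → ℤ, IsHaggSeq s ∧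
        ∃ Φ : EuclideanSpace ℝ (Fin 3) → EuclideanSpace ℝ (Fin 3),
          Set.BijOn Φ (barlowStacking 1 (Real.sqrt (2 / 3)) s) S ∧
          ∀ p ∈ barlowStacking 1 (Real.sqrt (2 / 3)) s, ∀ q ∈ barlowStacking 1 (Real.sqrt (2 / 3)) s,
            (dist p q = 1 ↔ (0 < dist (Φ p) (Φ q) ∧ dist (Φ p) (Φ q) < 6 / 5)) := by
    filter_upwards [hcore, hgood] with μ hc hg
    obtain ⟨S, rfl, hS⟩ := hg
    obtain ⟨S₀, h0, -, hμ⟩ := hc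
    have h0S : (0 : EuclideanSpace ℝ (Fin 3)) ∈ S := by
      have h1 : (Measure.count : Measure (EuclideanSpace ℝ (Fin 3))).restrict S {0} ≠ 0 := by
        rw [hμ]
        exact (count_restrict_singleton_ne_zero_iff S₀ 0).2 h0
      exact (count_restrict_singleton_ne_zero_iff S 0).1 h1
    obtain ⟨s, hs, Φ, hΦ, hbond⟩ :=
      Summit.AtomisticToContinuum.Crystallization.Theorems.PalmGoodLaw.FunnelChart.stub_funnelChart S ⟨0, h0S⟩ hS
    exact ⟨S, rfl, hS, s, hs, Φ, hΦ, hbond⟩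
  -- the relaxed reference and the level `E_P[h] ≤ e* ≤ hcpE a₀ h₀`
  obtain ⟨a₀, h₀, ha₁, ha₂, hh₁, hh₂, hmin⟩ := stub_relaxedReference
  have ha0 : 0 < a₀ := by linarith
  have hh0 : 0 < h₀ := by linarith
  have hstar : (⨅ Q : PeriodicConfiguration 3, Q.energyPerParticle lennardJones) ≤ hcpE a₀ h₀ :=
    Summit.AtomisticToContinuum.Crystallization.Theorems.PalmGoodLaw.RouteBetaFloor.iInf_le_hcpE ha0.ne' hh0.ne'
  have hlevel : (∫ μ, (∫ y, lennardJones ‖y‖ ∂μ) / 2 ∂P) ≤ hcpE a₀ h₀ := hE.trans hstar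
  -- the `e*`-level structure of minimising laws (landed)
  have hFB := Summit.AtomisticToContinuum.Crystallization.Theorems.PalmGoodLaw.RouteBetaFloor.ae_forceBalance_of_minimising
    hδ hcore hstat hE
  have hZS := Summit.AtomisticToContinuum.Crystallization.Theorems.PalmGoodLaw.RouteBetaFloor.zeroMeanStress_of_minimising
    hδ hcore hstat hE
  -- X1: the level is attained and the ROOT star is a.s. exact
  obtain ⟨hlow, hexact⟩ := ae_exactRoot_of_core hCORE ha₁ ha₂ hh₁ hh₂ hmin hδ hcore hstat hchart hFB hZS hlevel
  have heq : hcpE a₀ h₀ = ⨅ Q : PeriodicConfiguration 3, Q.energyPerParticle lennardJones :=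
    le_antisymm (hlow.trans hE) hstar
  -- every point a.s. (Aldous–Lyons; hard-core configurations are locally finite)
  have hlf : ∀ᵐ μ ∂P, ∀ n : ℕ,
      μ ((fun z : EuclideanSpace ℝ (Fin 3) => ⌊‖z‖⌋₊) ⁻¹' {n}) < ∞ := by
    filter_upwards [hcore] with μ hμ n
    obtain ⟨S, -, hsep, rfl⟩ := hμ
    exact count_restrict_floorNorm_preimage_lt_top hδ hsep n
  have hall := ae_forall_map_sub_of_ae hstat hlf hexact
  -- X2: a.s. an exact stacking
  have hstack : ∀ᵐ μ ∂P, ∃ A : EuclideanSpace ℝ (Fin 3) ≃ₗᵢ[ℝ] EuclideanSpace ℝ (Fin 3), ∃ h : ℝ,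
      (h = h₀ ∨ h = a₀ * Real.sqrt (2 / 3)) ∧ ∃ s : ℤ → ℤ, IsHaggSeq s ∧
        μ = (Measure.count : Measure (EuclideanSpace ℝ (Fin 3))).restrict (A '' barlowStacking a₀ h s) := by
    filter_upwards [hcore, hchart, hall] with μ hc hch ha
    obtain ⟨S, hμS, hgoodS, hch'⟩ := hch
    obtain ⟨S₀, h0, -, hμ0⟩ := hc
    have h0S : (0 : EuclideanSpace ℝ (Fin 3)) ∈ S := by
      have h1 : (Measure.count : Measure (EuclideanSpace ℝ (Fin 3))).restrict S {0} ≠ 0 := by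
        rw [← hμS, hμ0]
        exact (count_restrict_singleton_ne_zero_iff S₀ 0).2 h0
      exact (count_restrict_singleton_ne_zero_iff S 0).1 h1
    have hx : ∀ x ∈ S,
        (starDefect a₀ h₀
            ((Measure.count : Measure (EuclideanSpace ℝ (Fin 3))).restrict
              ((fun z : EuclideanSpace ℝ (Fin 3) => z - x) '' S)) = 0 ∨
          (⨅ A : EuclideanSpace ℝ (Fin 3) ≃ₗᵢ[ℝ] EuclideanSpace ℝ (Fin 3),
            ∑ p ∈ fccKissingPattern, Metric.infDist (A (a₀ • p))
              (rootStar ((Measure.count : Measure (EuclideanSpace ℝ (Fin 3))).restrict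
                ((fun z : EuclideanSpace ℝ (Fin 3) => z - x) '' S))) ^ 2) = 0) ∧
        (Measure.count : Measure (EuclideanSpace ℝ (Fin 3))).restrict ((fun z : EuclideanSpace ℝ (Fin 3) => z - x) '' S)
          {y : EuclideanSpace ℝ (Fin 3) | 11 / 10 < ‖y‖ ∧ ‖y‖ ≤ 5 / 4} = 0 := by
      intro x hxS
      have h1 := ha x (by rw [hμS]; exact (count_restrict_singleton_ne_zero_iff S x).2 hxS)
      rwa [hμS, map_sub_count_restrict] at h1
    obtain ⟨A, h, hh, s', hs', hS⟩ := ExactStarShortcutRigidity.stub_exactStarRigidity a₀ h₀ ha₁ ha₂ hh₁ hh₂ S h0S hgoodS hch' hx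
    exact ⟨A, h, hh, s', hs', by rw [hμS, hS]⟩
  -- X3: a.s. exact relaxed hcp
  have hhcp := ExactSelectionLawB.stub_exactSelectionLawB a₀ h₀ ha₁ ha₂ hh₁ hh₂ hmin δ hδ P hP hcore hstat hlevel hstack
  filter_upwards [hhcp] with μ hμ
  obtain ⟨A, hA⟩ := hμ
  refine ⟨a₀, h₀, ha0.ne', hh0.ne', by linarith, by linarith, by linarith, by linarith, A, ?_, hA⟩
  rw [← heq]
  exact ((Summit.AtomisticToContinuum.Crystallization.Theorems.ExcessDecayLiouvilleCoarseGrains.hcpEnergySeries_of_eq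
    a₀ h₀ ha0.ne' hh0.ne' hcpQ rfl).2.2)

/-- **THE CRUX MODULO ITS CORE ALONE (lead c9): `stub_funnelDefectFloor → DefectFreeCrystallizes`**, crux 9226 NOT used — the
geometry (X2) and the exact selection (X3) are landed.  Glue-by entry for the planner's split {FunnelDefectFloor := CORE}. [folklore] -/
theorem defectFreeCrystallizes_of_core :
    (∀ a₀ h₀ : ℝ, 189 / 200 ≤ a₀ → a₀ ≤ 199 / 200 → 77 / 100 ≤ h₀ → h₀ ≤ 163 / 200 →
      (∀ a h : ℝ, 0 < a → 0 < h →
        Summit.AtomisticToContinuum.Crystallization.Theorems.PalmUnimodularRigidity.LayeredLawsSelectHcp.hcpE a₀ h₀ ≤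
          Summit.AtomisticToContinuum.Crystallization.Theorems.PalmUnimodularRigidity.LayeredLawsSelectHcp.hcpE a h) →
      ∀ δ : ℝ, 0 < δ → ∃ κ : ℝ, 0 < κ ∧
        ∀ Dm : Measure (EuclideanSpace ℝ (Fin 3)) → ℝ≥0∞, Measurable Dm →
          (∀ μ : Measure (EuclideanSpace ℝ (Fin 3)), IsRootedHardCore δ μ →
            Dm μ = ENNReal.ofReal
              (min (Summit.AtomisticToContinuum.Crystallization.Theorems.PalmUnimodularRigidity.LayeredLawsSelectHcp.starDefect a₀ h₀ μ)
                  (⨅ A : EuclideanSpace ℝ (Fin 3) ≃ₗᵢ[ℝ] EuclideanSpace ℝ (Fin 3),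
                    ∑ p ∈ fccKissingPattern, Metric.infDist (A (a₀ • p)) (Summit.AtomisticToContinuum.Crystallization.Theorems.PalmUnimodularRigidity.LayeredLawsSelectHcp.rootStar μ) ^ 2) +
                (μ {y : EuclideanSpace ℝ (Fin 3) | 11 / 10 < ‖y‖ ∧ ‖y‖ ≤ 5 / 4}).toReal)) →
          ∀ P : Measure (Measure (EuclideanSpace ℝ (Fin 3))), IsProbabilityMeasure P →
            (∀ᵐ μ ∂P, IsRootedHardCore δ μ) → IsPointStationaryLaw P →
            (∀ᵐ μ ∂P, ∃ S : Set (EuclideanSpace ℝ (Fin 3)),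
              μ = (Measure.count : Measure (EuclideanSpace ℝ (Fin 3))).restrict S ∧
              (∀ y ∈ S, SetGood S y) ∧
              ∃ s : ℤ → ℤ, IsHaggSeq s ∧
                ∃ Φ : EuclideanSpace ℝ (Fin 3) → EuclideanSpace ℝ (Fin 3),
                  Set.BijOn Φ (barlowStacking 1 (Real.sqrt (2 / 3)) s) S ∧
                  ∀ p ∈ barlowStacking 1 (Real.sqrt (2 / 3)) s, ∀ q ∈ barlowStacking 1 (Real.sqrt (2 / 3)) s,
                    (dist p q = 1 ↔ (0 < dist (Φ p) (Φ q) ∧ dist (Φ p) (Φ q) < 6 / 5))) →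
            (∀ᵐ μ ∂P, ∃ S : Set (EuclideanSpace ℝ (Fin 3)),
              μ = (Measure.count : Measure (EuclideanSpace ℝ (Fin 3))).restrict S ∧
              ∀ p ∈ S, HasSum (fun q : {q : EuclideanSpace ℝ (Fin 3) // q ∈ S ∧ q ≠ p} =>
                (deriv lennardJones (dist p q.1) / dist p q.1) • (p - q.1)) 0) →
            (∀ M : EuclideanSpace ℝ (Fin 3) →L[ℝ] EuclideanSpace ℝ (Fin 3),
              ∫ μ, (∫ y, deriv lennardJones ‖y‖ / ‖y‖ * inner ℝ y (M y) ∂μ) ∂P = 0) →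
            Summit.AtomisticToContinuum.Crystallization.Theorems.PalmUnimodularRigidity.LayeredLawsSelectHcp.hcpE a₀ h₀ +
                κ * (∫⁻ μ, Dm μ ∂P).toReal ≤
              ∫ μ, (∫ y, lennardJones ‖y‖ ∂μ) / 2 ∂P) →
    Summit.AtomisticToContinuum.Crystallization.Theses.ReggeStarCoercivity.DefectFreeCrystallizes := fun hCORE =>
  defectFreeCrystallizes_iff.2 fun hZ =>
    Summit.AtomisticToContinuum.Crystallization.Theorems.chargedPatternCrystallizes_proof
      (Summit.AtomisticToContinuum.Crystallization.Theorems.PalmGoodLaw.ChargeFromFunnelLaw.stub_chargeFromFunnelLaw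
        Summit.AtomisticToContinuum.Crystallization.Theorems.PalmGoodLaw.stub_goodLaw
        (funnelLawRigidity_of_core hCORE) hZ)
      LennardJonesMinimalDistance_holds

end ExactStarGlue

end Summit.AtomisticToContinuum.Crystallization.Theorems.PalmGoodLaw.ExactStarShortcut

end
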